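import Literature.NumberTheory.EllipticCurves.CuspFormTwistAtkinLehnerCoprimeProofs
import Literature.NumberTheory.EllipticCurves.RootNumberTwistProofs
import HarnessLib

/-!
# The Atkin–Lehner eigenvalues of the twist of a newform by `(·/q)(·/ℓ)` at a third prime — in particular at `2`
# (Atkin–Li 1978 §1 / Shemanske–Walling 1993 Prop. 5.4, iterated) — proofs

A `…Proofs` companion (theorems only: no definition, no named fact, no instance) of
`CuspFormTwistAtkinLehnerCoprimeProofs` (`w_Q f_χ = χ(Q) (w_Q f)_χ` for a character `χ` modulo ONE prime and an exact
divisor `Q` prime to it). Here the twist is by the product of two Legendre characters `(·/q)(·/ℓ)` at distinct odd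
primes `q ≠ ℓ` — the quadratic character of `ℚ(√(qℓ))` when `q ≡ ℓ (mod 4)` —, obtained by twisting twice, and the
prime `r ∉ {q, ℓ}` at which the eigenvalue is read is arbitrary; the case that matters downstream is `r = 2`:

* `atkinLehnerEigenvalueAt_eq_of_cuspCoeff_eq_legendreSym_mul` — if `f' ∈ S_k(Γ₀(L))` has the `q`-expansion
  `aₙ(f') = (n/q)(n/ℓ) aₙ(f)` of the double twist of a `w_{Q_r}`-eigenform `f ∈ S_k(Γ₀(N))` (`w_{Q_r} f = ε f`, `N ∣ L`,
  `q², ℓ² ∣ L`, `v_r(N) = v_r(L)`), then `λ_r(f') = (r^{v_r(L)}/q)(r^{v_r(L)}/ℓ) · ε` (`f'` IS the double twist by the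
  `q`-expansion principle; each twist multiplies the `w_{Q_r}`-eigenvalue by `χ(Q_r)`);
* `cuspCoeff_eq_legendreSym_mul_of_quadraticTwist_mul` — for an elliptic curve `E/ℚ` and its twist `E' = E^{(qℓ)}`,
  `q ≡ ℓ (mod 4)`, ADDITIVE at `q` and at `ℓ`: the newforms satisfy `aₙ(f') = (n/q)(n/ℓ) aₙ(f)` for EVERY `n`
  (`qℓ = q*·ℓ*`, so `E' = (E^{(q*)})^{(ℓ*)}` and `LFunction_quadraticTwist_pStar_apply` applies twice away from `qℓ`;
  at `n` divisible by `q` or `ℓ` both sides vanish);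
* `atkinLehnerEigenvalueAt_two_eq_of_quadraticTwist_mul` — **`λ₂(f_{E^{(qℓ)}}) = λ₂(f_E)`** when `qℓ ≡ 1 (mod 8)`,
  `2 ∣ N_E`, `q ∥ N_E` and `N_{E'} = N_E · q · ℓ²` (so `v₂` is the same on both levels and `(2/q)(2/ℓ) = χ₈(qℓ) = 1`).
  This is the modular input at an ADDITIVE prime `2` of the root-number comparison `w(E^{(qℓ)}) = w(E)` (the tree's
  engines `TwistRootNumberOdd*` read `λ₂` through the local root number, which the tree only has at a semistable `2`).

Everything here is proved from the tree; no named facts are introduced.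

## References

* A. O. L. Atkin, W.-C. W. Li, *Twists of newforms and pseudo-eigenvalues of `W`-operators*, Invent. Math. 48 (1978),
  221–243, §1 and §3.
* T. R. Shemanske, L. H. Walling, *Twists of Hilbert modular forms*, Trans. AMS 340 (1993), Prop. 5.4.
* J. H. Silverman, *The Arithmetic of Elliptic Curves*, 2nd ed. 2009, X.2 Prop. 2.4, Exercise 10.16.
-/

noncomputable section

open scoped MatrixGroups Classical

open CongruenceSubgroup IsDedekindDomain IsDedekindDomain.HeightOneSpectrum NumberField Rat.HeightOneSpectrum

namespace Literature.NumberTheory.EllipticCurves.ModularForms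

/-! ### §1 The modular core: the double twist by `(·/q)(·/ℓ)` and its Atkin–Lehner eigenvalue at a third prime -/

section Modular

variable {q ℓ : ℕ} [Fact q.Prime] [Fact ℓ.Prime] {N L : ℕ} [NeZero N] [NeZero L] {k : ℤ}

/-- `(a^n / p) = (a/p)^n`. [folklore] -/
private theorem legendreSym_pow (p : ℕ) [Fact p.Prime] (a : ℤ) (n : ℕ) : legendreSym p (a ^ n) = legendreSym p a ^ n :=
  map_pow (legendreSym.hom p) a n

/-- **`λ_r(f') = (r^{v_r(L)}/q)(r^{v_r(L)}/ℓ) · ε` for a form `f'` with the `q`-expansion of the double twist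
`f ⊗ (·/q)(·/ℓ)` of a `w_{Q_r}`-eigenform `f` (`w_{Q_r} f = ε f`)**, `q ≠ ℓ` odd primes, `r` a third prime dividing the
level `L` of `f'` with the same exponent in `N` and `L`, `N ∣ L`, `q² ∣ L`, `ℓ² ∣ L`. By the `q`-expansion principle `f'` is
`((f)_{χ_q})_{χ_ℓ}` (`cuspCoeff_charTwist` twice, the Legendre characters being primitive), and each twist multiplies the
`w_{Q_r}`-eigenvalue by `χ(Q_r)` (`atkinLehnerInvolutionAt_charTwist_of_coprime_of_eq_smul`, Shemanske–Walling Prop. 5.4 /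
Atkin–Li §1). [cite: ShemanskeWalling1993, Prop. 5.4] [cite: AtkinLi1978, §1 and §3] -/
theorem atkinLehnerEigenvalueAt_eq_of_cuspCoeff_eq_legendreSym_mul (hq2 : q ≠ 2) (hℓ2 : ℓ ≠ 2)
    (hNL : N ∣ L) (hqL : q ^ 2 ∣ L) (hℓL : ℓ ^ 2 ∣ L) {r : ℕ} (hr : r ∈ L.primeFactors) (hrq : r ≠ q)
    (hrℓ : r ≠ ℓ) (hv : N.factorization r = L.factorization r) {f : CuspForm (Gamma0 N) k}
    {f' : CuspForm (Gamma0 L) k} (hf'0 : f' ≠ 0) {ε : ℂ} (hε : atkinLehnerInvolutionAt N k r f = ε • f)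
    (hcoeff : ∀ n : ℕ, cuspCoeff f' n = (legendreSym q n : ℂ) * (legendreSym ℓ n : ℂ) * cuspCoeff f n) :
    atkinLehnerEigenvalueAt f' r =
      (legendreSym q (r ^ L.factorization r : ℕ) : ℂ) * (legendreSym ℓ (r ^ L.factorization r : ℕ) : ℂ) * ε := by
  set χq : DirichletCharacter ℂ q := (quadraticChar (ZMod q)).ringHomComp (Int.castRingHom ℂ) with hχq
  set χℓ : DirichletCharacter ℂ ℓ := (quadraticChar (ZMod ℓ)).ringHomComp (Int.castRingHom ℂ) with hχℓ
  have hQq := isQuadratic_quadraticChar_ringHomComp q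
  have hQℓ := isQuadratic_quadraticChar_ringHomComp ℓ
  have hPq := isPrimitive_quadraticChar_ringHomComp q hq2
  have hPℓ := isPrimitive_quadraticChar_ringHomComp ℓ hℓ2
  -- the two twists, at the common level `L`
  set g₁ : CuspForm (Gamma0 L) k := charTwist L hNL hqL hQq f with hg₁
  set g₂ : CuspForm (Gamma0 L) k := charTwist L (dvd_refl L) hℓL hQℓ g₁ with hg₂
  have h₁ : atkinLehnerInvolutionAt L k r g₁ = (χq (r ^ L.factorization r : ℕ) * ε) • g₁ :=
    atkinLehnerInvolutionAt_charTwist_of_coprime_of_eq_smul L hNL hqL hr hrq hv hQq hε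
  have h₂ : atkinLehnerInvolutionAt L k r g₂ =
      (χℓ (r ^ L.factorization r : ℕ) * (χq (r ^ L.factorization r : ℕ) * ε)) • g₂ :=
    atkinLehnerInvolutionAt_charTwist_of_coprime_of_eq_smul L (dvd_refl L) hℓL hr hrℓ rfl hQℓ h₁
  -- `f'` IS the double twist
  have hfeq : f' = g₂ := by
    refine eq_of_forall_cuspCoeff_eq_gamma0 fun n ↦ ?_
    rw [hg₂, cuspCoeff_charTwist L (dvd_refl L) hℓL hQℓ hPℓ g₁ n, hg₁, cuspCoeff_charTwist L hNL hqL hQq hPq f n,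
      hcoeff n, quadraticChar_ringHomComp_apply_natCast, quadraticChar_ringHomComp_apply_natCast]
    ring
  rw [hfeq] at hf'0 ⊢
  rw [atkinLehnerEigenvalueAt_eq_of_eq_smul hf'0 h₂]
  simp only [hχq, hχℓ, quadraticChar_ringHomComp_apply_natCast]
  ring

/-- **The case `r = 2`, `qℓ ≡ 1 (mod 8)`: `λ₂(f') = ε`** — since `(2^v/q)(2^v/ℓ) = ((2/q)(2/ℓ))^v = χ₈(qℓ)^v = 1`.
[cite: ShemanskeWalling1993, Prop. 5.4] [cite: AtkinLi1978, §1 and §3] -/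
theorem atkinLehnerEigenvalueAt_two_eq_of_cuspCoeff_eq_legendreSym_mul (hq2 : q ≠ 2) (hℓ2 : ℓ ≠ 2)
    (h8 : ((q : ℤ) * ℓ) % 8 = 1) (hNL : N ∣ L) (hqL : q ^ 2 ∣ L) (hℓL : ℓ ^ 2 ∣ L) (h2 : 2 ∈ L.primeFactors)
    (hv : N.factorization 2 = L.factorization 2) {f : CuspForm (Gamma0 N) k} {f' : CuspForm (Gamma0 L) k}
    (hf'0 : f' ≠ 0) {ε : ℂ} (hε : atkinLehnerInvolutionAt N k 2 f = ε • f)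
    (hcoeff : ∀ n : ℕ, cuspCoeff f' n = (legendreSym q n : ℂ) * (legendreSym ℓ n : ℂ) * cuspCoeff f n) :
    atkinLehnerEigenvalueAt f' 2 = ε := by
  have hq : q.Prime := Fact.out
  have hℓ : ℓ.Prime := Fact.out
  rw [atkinLehnerEigenvalueAt_eq_of_cuspCoeff_eq_legendreSym_mul hq2 hℓ2 hNL hqL hℓL h2 (Ne.symm hq2) (Ne.symm hℓ2) hv
    hf'0 hε hcoeff]
  -- `(2^v/q)(2^v/ℓ) = (χ₈ q χ₈ ℓ)^v = χ₈(qℓ)^v = 1`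
  have h1 : (q : ZMod 8) * (ℓ : ZMod 8) = 1 := by
    set d : ℤ := (q : ℤ) * ℓ with hd
    have hdvd : (8 : ℤ) ∣ d - 1 := by omega
    have h0 := (ZMod.intCast_zmod_eq_zero_iff_dvd (d - 1) 8).mpr (by exact_mod_cast hdvd)
    rw [hd] at h0
    push_cast at h0
    linear_combination h0
  have hprod : legendreSym q (2 ^ L.factorization 2 : ℕ) * legendreSym ℓ (2 ^ L.factorization 2 : ℕ) = 1 := by
    push_cast
    rw [legendreSym_pow, legendreSym_pow, ← mul_pow, legendreSym.at_two hq2, legendreSym.at_two hℓ2, ← map_mul, h1,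
      map_one, one_pow]
  have h : ((legendreSym q (2 ^ L.factorization 2 : ℕ) : ℤ) : ℂ) * ((legendreSym ℓ (2 ^ L.factorization 2 : ℕ) : ℤ) : ℂ)
      = 1 := by exact_mod_cast hprod
  rw [h, one_mul]

end Modular

end Literature.NumberTheory.EllipticCurves.ModularForms

/-! ### §2 The curve side: the `q`-expansion of the newform of `E^{(qℓ)}` -/

namespace WeierstrassCurve

open Literature.NumberTheory.EllipticCurves.ModularForms

variable (W : WeierstrassCurve ℚ) [W.IsElliptic]

/-- `q* · ℓ* = qℓ` for odd primes `q ≡ ℓ (mod 4)` (`p* = (−1)^{(p−1)/2} p`). [folklore] -/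
private theorem pStar_mul_pStar_eq_mul {q ℓ : ℕ} (h4 : q % 4 = ℓ % 4) :
    ((-1 : ℤ) ^ (q / 2) * q) * ((-1 : ℤ) ^ (ℓ / 2) * ℓ) = q * ℓ := by
  have heven : Even (q / 2 + ℓ / 2) := ⟨q / 4 + ℓ / 4 + q % 4 / 2, by omega⟩
  calc ((-1 : ℤ) ^ (q / 2) * q) * ((-1 : ℤ) ^ (ℓ / 2) * ℓ) = (-1 : ℤ) ^ (q / 2 + ℓ / 2) * (q * ℓ) := by ring
    _ = q * ℓ := by rw [heven.neg_one_pow, one_mul]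

/-- **`aₙ(f') = (n/q)(n/ℓ) aₙ(f)` for EVERY `n`**, for the newforms `f` of `E` and `f'` of `E' = E^{(qℓ)}`, `q ≠ ℓ` odd primes
with `q ≡ ℓ (mod 4)`, PROVIDED `E'` is additive at `q` and at `ℓ` (e.g. `E` multiplicative at `q` and good at `ℓ`): away from
`qℓ` this is `E' = (E^{(q*)})^{(ℓ*)}` and `aₙ(X^{(p*)}) = (n/p) aₙ(X)` twice (`LFunction_quadraticTwist_pStar_apply`); at `n`
divisible by `q` or `ℓ` both sides vanish (`LFunction_apply_eq_zero_of_hasAdditiveReductionAt`).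
[cite: SilvermanAEC2009, X.2 Prop. 2.4 and Exercise 10.16] -/
theorem cuspCoeff_eq_legendreSym_mul_of_quadraticTwist_mul {q ℓ : ℕ} [Fact q.Prime] [Fact ℓ.Prime] (hq2 : q ≠ 2)
    (hℓ2 : ℓ ≠ 2) (h4 : q % 4 = ℓ % 4) {vq vℓ : HeightOneSpectrum (𝓞 ℚ)} (hvq : (primesEquiv vq : ℕ) = q)
    (hvℓ : (primesEquiv vℓ : ℕ) = ℓ)
    (haddq : (W.quadraticTwist (((q : ℤ) * ℓ : ℤ) : ℚ)).HasAdditiveReductionAt vq)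
    (haddℓ : (W.quadraticTwist (((q : ℤ) * ℓ : ℤ) : ℚ)).HasAdditiveReductionAt vℓ)
    {N N' : ℕ} [NeZero N] [NeZero N'] {f : CuspForm (Gamma0 N) 2} {f' : CuspForm (Gamma0 N') 2}
    (hf : IsNewformOf W f) (hf' : IsNewformOf (W.quadraticTwist (((q : ℤ) * ℓ : ℤ) : ℚ)) f') (n : ℕ) :
    cuspCoeff f' n = (legendreSym q n : ℂ) * (legendreSym ℓ n : ℂ) * cuspCoeff f n := by
  have hq : q.Prime := Fact.out
  have hℓ : ℓ.Prime := Fact.out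
  have hd0Z : ((q : ℤ) * ℓ : ℤ) ≠ 0 := mul_ne_zero (by exact_mod_cast hq.ne_zero) (by exact_mod_cast hℓ.ne_zero)
  have hd0 : (((q : ℤ) * ℓ : ℤ) : ℚ) ≠ 0 := by exact_mod_cast hd0Z
  haveI : (W.quadraticTwist (((q : ℤ) * ℓ : ℤ) : ℚ)).IsElliptic := W.isElliptic_quadraticTwist hd0
  rw [hf'.2 n, hf.2 n]
  by_cases hqn : q ∣ n
  · have h0 : legendreSym q n = 0 :=
      (legendreSym.eq_zero_iff q n).mpr (by exact_mod_cast (ZMod.natCast_eq_zero_iff n q).mpr hqn)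
    rw [LFunction_apply_eq_zero_of_hasAdditiveReductionAt _ hvq haddq hqn, h0]
    push_cast
    ring
  by_cases hℓn : ℓ ∣ n
  · have h0 : legendreSym ℓ n = 0 :=
      (legendreSym.eq_zero_iff ℓ n).mpr (by exact_mod_cast (ZMod.natCast_eq_zero_iff n ℓ).mpr hℓn)
    rw [LFunction_apply_eq_zero_of_hasAdditiveReductionAt _ hvℓ haddℓ hℓn, h0]
    push_cast
    ring
  -- away from `qℓ`: `E' = (E^{(q*)})^{(ℓ*)}`
  have hqs0Z : ((-1 : ℤ) ^ (q / 2) * q : ℤ) ≠ 0 := mul_ne_zero (pow_ne_zero _ (by norm_num)) (by exact_mod_cast hq.ne_zero)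
  have hqs0 : (((-1 : ℤ) ^ (q / 2) * q : ℤ) : ℚ) ≠ 0 := by exact_mod_cast hqs0Z
  haveI : (W.quadraticTwist (((-1 : ℤ) ^ (q / 2) * q : ℤ) : ℚ)).IsElliptic := W.isElliptic_quadraticTwist hqs0
  have key : W.quadraticTwist (((q : ℤ) * ℓ : ℤ) : ℚ) =
      (W.quadraticTwist (((-1 : ℤ) ^ (q / 2) * q : ℤ) : ℚ)).quadraticTwist (((-1 : ℤ) ^ (ℓ / 2) * ℓ : ℤ) : ℚ) := by
    rw [quadraticTwist_quadraticTwist, ← Int.cast_mul, pStar_mul_pStar_eq_mul h4]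
  rw [key, (W.quadraticTwist _).LFunction_quadraticTwist_pStar_apply hℓ2 hℓn, W.LFunction_quadraticTwist_pStar_apply hq2 hqn]
  push_cast
  ring

/-- **`λ₂(f_{E'}) = λ₂(f_E)` for `E' = E^{(qℓ)}`, `qℓ ≡ 1 (mod 8)`** (`q ≠ ℓ` odd primes, `E'` additive at `q` and at `ℓ`, `2 ∣ N_E`,
`q ∣ N_E`, and the levels related by `N_{E'} = N_E · q · ℓ²` — the situation of a curve multiplicative at `q` and good at `ℓ`): the
newform of `E'` is the double twist of that of `E`, at a level with the same power of `2`, and `(2/q)(2/ℓ) = 1`. No hypothesis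
on the reduction of `E` at `2` (additive allowed). [cite: AtkinLi1978, §1 and §3] [cite: ShemanskeWalling1993, Prop. 5.4] -/
theorem atkinLehnerEigenvalueAt_two_eq_of_quadraticTwist_mul {q ℓ : ℕ} [Fact q.Prime] [Fact ℓ.Prime] (hq2 : q ≠ 2)
    (hℓ2 : ℓ ≠ 2) (h8 : ((q : ℤ) * ℓ) % 8 = 1) {vq vℓ : HeightOneSpectrum (𝓞 ℚ)}
    (hvq : (primesEquiv vq : ℕ) = q) (hvℓ : (primesEquiv vℓ : ℕ) = ℓ)
    (haddq : (W.quadraticTwist (((q : ℤ) * ℓ : ℤ) : ℚ)).HasAdditiveReductionAt vq)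
    (haddℓ : (W.quadraticTwist (((q : ℤ) * ℓ : ℤ) : ℚ)).HasAdditiveReductionAt vℓ)
    {N N' : ℕ} [NeZero N] [NeZero N'] {f : CuspForm (Gamma0 N) 2} {f' : CuspForm (Gamma0 N') 2}
    (hf : IsNewformOf W f) (hf' : IsNewformOf (W.quadraticTwist (((q : ℤ) * ℓ : ℤ) : ℚ)) f')
    (hN' : N' = N * q * ℓ ^ 2) (h2N : 2 ∣ N) (hqN : q ∣ N) :
    atkinLehnerEigenvalueAt f' 2 = atkinLehnerEigenvalueAt f 2 := by
  have hq : q.Prime := Fact.out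
  have hℓ : ℓ.Prime := Fact.out
  subst hN'
  have hN0 : N ≠ 0 := NeZero.ne N
  -- `q ≡ ℓ (mod 4)` from `qℓ ≡ 1 (mod 8)`
  have h4 : q % 4 = ℓ % 4 := by
    have hqo : q % 2 = 1 := Nat.odd_iff.mp (hq.odd_of_ne_two hq2)
    have hℓo : ℓ % 2 = 1 := Nat.odd_iff.mp (hℓ.odd_of_ne_two hℓ2)
    have hq4 : (q : ℤ) % 4 = 1 ∨ (q : ℤ) % 4 = 3 := by omega
    have hℓ4 : (ℓ : ℤ) % 4 = 1 ∨ (ℓ : ℤ) % 4 = 3 := by omega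
    have hm : ((q : ℤ) * ℓ) % 4 = 1 := by
      set d : ℤ := (q : ℤ) * ℓ
      omega
    have hm' : ((q : ℤ) % 4) * ((ℓ : ℤ) % 4) % 4 = 1 := by rw [← Int.mul_emod, hm]
    rcases hq4 with hq4 | hq4 <;> rcases hℓ4 with hℓ4 | hℓ4 <;> rw [hq4, hℓ4] at hm' <;> norm_num at hm' <;> omega
  have hcoeff := W.cuspCoeff_eq_legendreSym_mul_of_quadraticTwist_mul hq2 hℓ2 h4 hvq hvℓ haddq haddℓ hf hf'
  have hNL : N ∣ N * q * ℓ ^ 2 := ⟨q * ℓ ^ 2, by ring⟩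
  have hqL : q ^ 2 ∣ N * q * ℓ ^ 2 := by
    obtain ⟨c, hc⟩ := hqN
    exact ⟨c * ℓ ^ 2, by rw [hc]; ring⟩
  have hℓL : ℓ ^ 2 ∣ N * q * ℓ ^ 2 := dvd_mul_left _ _
  have h2L : 2 ∈ (N * q * ℓ ^ 2).primeFactors :=
    Nat.mem_primeFactors.mpr ⟨Nat.prime_two, h2N.trans hNL, NeZero.ne _⟩
  have hv : N.factorization 2 = (N * q * ℓ ^ 2).factorization 2 := by
    rw [Nat.factorization_mul (mul_ne_zero hN0 hq.ne_zero) (pow_ne_zero _ hℓ.ne_zero),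
      Nat.factorization_mul hN0 hq.ne_zero, Nat.factorization_pow]
    simp [hq.factorization, hℓ.factorization, hq2, hℓ2]
  have hf'0 : f' ≠ 0 := fun h0 ↦ hf'.1.coe_ne_zero (by rw [h0]; rfl)
  have hε := IsNewform0.atkinLehnerInvolutionAt_eq_atkinLehnerEigenvalueAt_smul hf.1 Nat.prime_two h2N
  exact atkinLehnerEigenvalueAt_two_eq_of_cuspCoeff_eq_legendreSym_mul hq2 hℓ2 h8 hNL hqL hℓL h2L hv hf'0 hε hcoeff

end WeierstrassCurve

end
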